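import Summits.Schanuel.Schanuel.Theorems.ZilberEacFixedFibreDensity
import Summits.Schanuel.Schanuel.Theorems.ZilberEacPlaneTheorem
import HarnessLib

/-!
# THE PLANE THEOREM for ALL fibre polynomials

Zilber's Exponential-Algebraic Closedness, case ladder (host summit Schanuel, cell `pub-schanuel`,
seat 2, gen 15; closes HANDOFF O60′ (ii′)).  `unprojectedDense_polyFibredGraph_realPlane` /
`…_plane_all` assumed `F₀F₁ ≠ 0`.  With the FIXED-POINT-FIBRE regime
(`unprojectedDense_polyFibredGraph_fixedFibre`, `…_zeroFibres`) the zero fibre polynomials are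
covered too: for `F₁ = 0 ≠ F₀` the regime needs `∃ β > 0, 0 < r₀ + βr₁ < 1/e₀`, available exactly
when (`r₁ > 0`, `r₀e₀ < 1`) or (`r₁ < 0 < r₀`) or (`r₁ = 0`, `0 < r₀e₀ < 1`); the complement is the
positive quadrant with `r₀e₀ ≥ 1` (H125 `…_hyperplane_pos`), `r₀, r₁ ≤ 0`-type planes (H108, slow,
`λ = r₀ + r₁ ≤ 0`) and the axis `r₁ = 0` with `r₀e₀ > 1` (`…_hyperplane_axis`) or `r₀ < 0` (H108);
`F₀ = 0 ≠ F₁` by the swap; `F₀ = F₁ = 0` by `…_zeroFibres`.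

* **`unprojectedDense_polyFibredGraph_realPlane_all (F) (r₀ r₁ : ℝ) (r₀ ∉ ℚ ∨ r₁ ∉ ℚ) (c)`** and
  **`unprojectedDense_polyFibredGraph_plane_every (F) (r : Fin 2 → ℂ) (∃ i, rᵢ ∉ ℚ) (c)`** —
  `I(W ∩ Γ_exp) = I(W)` for `W = {x₂ = r₀x₀ + r₁x₁ + c, yⱼ = xⱼ + y₂Fⱼ(y₂)}`, EVERY `F₀, F₁ ∈ ℂ[u]`.

HONEST FRAMING: one explicit 3-fold family inside the OPEN cell `EC(3,2)`; `EC(3,2)` OPEN; NOT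
Schanuel's conjecture; EAC ⇏ SC.
-/

noncomputable section

open Complex MvPolynomial Filter Topology
open Literature.NumberTheory.Transcendental Literature.ModelTheory.Zilber
  Literature.ModelTheory.ExponentialFields

set_option linter.dupNamespace false

namespace Summit.Schanuel.Schanuel.Theorems

section PlaneAll

/-- **`F₁ = 0`, `F₀ ≠ 0`, every real plane with an irrational coefficient**: dense. (new)
[cite: MantovaMasser2023, §1 p.5 (the open case dim π(V) = 2 in ℂ³×ℂˣ³)] -/
theorem unprojectedDense_polyFibredGraph_realPlane_zeroSnd (F : Fin 2 → Polynomial ℂ)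
    (hF0 : F 0 ≠ 0) (hF1 : F 1 = 0) (r₀ r₁ : ℝ) (hirr : Irrational r₀ ∨ Irrational r₁) (c : ℂ) :
    UnprojectedDense (polyFibredGraph (hyperplanePoly ![r₀, r₁] c) (fun j => X j)
      (fun j => (F j).toMvPolynomial 0)) := by
  set e₀ : ℝ := (((F 0).natDegree + 1 : ℕ) : ℝ) with he₀def
  have he₀ : 0 < e₀ := by rw [he₀def]; positivity
  have he₀1 : 1 ≤ e₀ := by rw [he₀def]; exact_mod_cast Nat.le_add_left 1 _
  -- the slow regime whenever `λ = r₀ + r₁ ≤ 0`... packaged: H108 with `max λ 0 = 0`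
  have hslow : r₀ + r₁ ≤ 0 → UnprojectedDense (polyFibredGraph (hyperplanePoly ![r₀, r₁] c)
      (fun j => X j) (fun j => (F j).toMvPolynomial 0)) := by
    intro hle
    refine unprojectedDense_polyFibredGraph_hyperplane ![r₀, r₁] c ?_ (fun j => X j)
      (fun j => X_ne_zero j) F fun j => ?_
    · rcases hirr with h | h
      · exact ⟨0, by simpa using h⟩
      · exact ⟨1, by simpa using h⟩
    · have hsum : ∑ i : Fin 2, (![r₀, r₁] : Fin 2 → ℝ) i * ((X i : MvPolynomial (Fin 2) ℂ).totalDegree : ℝ)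
          = r₀ + r₁ := by
        rw [Fin.sum_univ_two]
        simp [MvPolynomial.totalDegree_X]
      rw [hsum, max_eq_right hle, MvPolynomial.totalDegree_X]
      simp only [zero_mul, add_zero, Nat.cast_one]
      linarith
  -- the fixed-point-fibre regime whenever an admissible `β` exists
  have hfix : ∀ β : ℝ, 0 < β → 0 < r₀ + β * r₁ → (r₀ + β * r₁) * e₀ < 1 →
      UnprojectedDense (polyFibredGraph (hyperplanePoly ![r₀, r₁] c) (fun j => X j)
        (fun j => (F j).toMvPolynomial 0)) := fun β hβ hlo hhi =>
    unprojectedDense_polyFibredGraph_fixedFibre F hF1 r₀ r₁ hirr c ⟨β, hβ, hlo, hhi⟩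
  rcases lt_trichotomy r₁ 0 with h1 | h1 | h1
  · -- `r₁ < 0`
    by_cases h0 : r₀ ≤ 0
    · exact hslow (by linarith)
    · have h0' : 0 < r₀ := not_le.1 h0
      have hr₁ : r₁ ≠ 0 := h1.ne
      -- `β` slightly below `r₀/|r₁|`: `r₀ + βr₁` small positive
      obtain ⟨μ, hμ⟩ : ∃ μ : ℝ, min (r₀ / 2) (1 / (2 * e₀)) = μ := ⟨_, rfl⟩
      have hmpos : 0 < μ := by rw [← hμ]; exact lt_min (by linarith) (by positivity)
      have hmle : μ ≤ r₀ / 2 := by rw [← hμ]; exact min_le_left _ _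
      have hmle' : μ ≤ 1 / (2 * e₀) := by rw [← hμ]; exact min_le_right _ _
      set β : ℝ := (r₀ - μ) / (-r₁) with hβdef
      have hsum : r₀ + β * r₁ = μ := by
        rw [hβdef]; field_simp; ring
      refine hfix β (div_pos (by linarith) (by linarith)) (by rw [hsum]; exact hmpos) ?_
      rw [hsum]
      calc μ * e₀ ≤ 1 / (2 * e₀) * e₀ := mul_le_mul_of_nonneg_right hmle' he₀.le
        _ = 1 / 2 := by field_simp
        _ < 1 := by norm_num
  · -- `r₁ = 0`: the axis
    subst h1
    have hirr0 : Irrational r₀ := hirr.resolve_right not_irrational_zero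
    by_cases hax : r₀ < 0 ∨ 1 < e₀ * r₀
    · exact unprojectedDense_polyFibredGraph_hyperplane_axis F hF0 r₀ hirr0 c hax
    rw [not_or, not_lt, not_lt] at hax
    have hr₀ : 0 < r₀ := lt_of_le_of_ne hax.1 (Ne.symm hirr0.ne_zero)
    have hne : r₀ * e₀ ≠ 1 := irrational_mul_natCast_ne_one hirr0 _
    have hlt : r₀ * e₀ < 1 := lt_of_le_of_ne (by rw [mul_comm]; exact hax.2) hne
    exact hfix 1 one_pos (by linarith) (by linarith)
  · -- `r₁ > 0`
    by_cases h0 : r₀ * e₀ < 1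
    · -- `β` small: `r₀ + βr₁ ∈ (0, 1/e₀)`
      by_cases hr₀ : 0 < r₀
      · set β : ℝ := (1 / e₀ - r₀) / (2 * r₁) with hβdef
        have hgap : 0 < 1 / e₀ - r₀ := by
          rw [sub_pos, lt_div_iff₀ he₀]; linarith
        have hsum : r₀ + β * r₁ = (r₀ + 1 / e₀) / 2 := by rw [hβdef]; field_simp; ring
        refine hfix β (by positivity) (by rw [hsum]; positivity) ?_
        rw [hsum]
        have : (r₀ + 1 / e₀) / 2 * e₀ = (r₀ * e₀ + 1) / 2 := by field_simp
        rw [this]; linarith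
      · have hr₀' : r₀ ≤ 0 := not_lt.1 hr₀
        set β : ℝ := (1 / (2 * e₀) - r₀) / r₁ with hβdef
        have hsum : r₀ + β * r₁ = 1 / (2 * e₀) := by rw [hβdef]; field_simp; ring
        refine hfix β (div_pos (by linarith [show 0 < 1 / (2 * e₀) by positivity]) h1)
          (by rw [hsum]; positivity) ?_
        rw [hsum]
        have : 1 / (2 * e₀) * e₀ = 1 / 2 := by field_simp
        rw [this]; norm_num
    · -- `r₀e₀ ≥ 1`, `r₁ > 0`: the positive quadrant
      have h0' : 1 ≤ r₀ * e₀ := not_lt.1 h0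
      have hr₀ : 0 < r₀ := by
        by_contra h
        have h' : r₀ ≤ 0 := not_lt.1 h
        nlinarith
      exact unprojectedDense_polyFibredGraph_hyperplane_pos F hF0 r₀ r₁ hr₀ h1 hirr c

/-- **THE REAL PLANE THEOREM, all fibre polynomials**: `F₀, F₁ ∈ ℂ[u]` arbitrary,
`r₀ ∉ ℚ ∨ r₁ ∉ ℚ`, any `c` ⟹ `I(W ∩ Γ_exp) = I(W)`. (new)
[cite: MantovaMasser2023, §1 p.5 (the open case dim π(V) = 2 in ℂ³×ℂˣ³)] -/
theorem unprojectedDense_polyFibredGraph_realPlane_all (F : Fin 2 → Polynomial ℂ)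
    (r₀ r₁ : ℝ) (hirr : Irrational r₀ ∨ Irrational r₁) (c : ℂ) :
    UnprojectedDense (polyFibredGraph (hyperplanePoly ![r₀, r₁] c) (fun j => X j)
      (fun j => (F j).toMvPolynomial 0)) := by
  by_cases hF0 : F 0 = 0
  · by_cases hF1 : F 1 = 0
    · exact unprojectedDense_polyFibredGraph_zeroFibres F hF0 hF1 r₀ r₁ hirr c
    · -- swap: `F₀ = 0 ≠ F₁`
      have h := unprojectedDense_polyFibredGraph_realPlane_zeroSnd (F ∘ Equiv.swap (0 : Fin 2) 1)
        (by simpa using hF1) (by simpa using hF0) r₁ r₀ hirr.symm c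
      rw [← unprojectedDense_compPerm_iff (Equiv.swap (0 : Fin 3) 1), polyFibredGraph_hyperplane_swap] at h
      exact h
  · by_cases hF1 : F 1 = 0
    · exact unprojectedDense_polyFibredGraph_realPlane_zeroSnd F hF0 hF1 r₀ r₁ hirr c
    · exact unprojectedDense_polyFibredGraph_realPlane F hF0 hF1 r₀ r₁ hirr c

/-- **THE PLANE THEOREM, every fibre polynomial, complex coefficients**: some `rⱼ ∉ ℚ`, any `c`,
ANY `F₀, F₁` ⟹ `I(W ∩ Γ_exp) = I(W)` for `W = {x₂ = r₀x₀ + r₁x₁ + c, yⱼ = xⱼ + y₂Fⱼ(y₂)}`. (new)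
[cite: MantovaMasser2023, §1 p.5 (the open case dim π(V) = 2 in ℂ³×ℂˣ³)] -/
theorem unprojectedDense_polyFibredGraph_plane_every (F : Fin 2 → Polynomial ℂ)
    (r : Fin 2 → ℂ) (hirr : ∃ i, ∀ ρ : ℚ, r i ≠ (ρ : ℂ)) (c : ℂ) :
    UnprojectedDense (polyFibredGraph (∑ i, C (r i) * X i + C c) (fun j => X j)
      (fun j => (F j).toMvPolynomial 0)) := by
  classical
  by_cases him : ∃ i, (r i).im ≠ 0
  · obtain ⟨q₀, hq₀0, hq₀⟩ := exists_latticeDir_of_im_ne_zero r him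
    exact unprojectedDense_polyFibredGraph_hyperplaneC r c q₀ hq₀0 hq₀ (fun j => X j)
      (fun j => X_ne_zero j) _
  have him' : ∀ i, (r i).im = 0 := fun i => by
    by_contra h
    exact him ⟨i, h⟩
  set rr : Fin 2 → ℝ := fun i => (r i).re with hrr
  have hr_eq : ∀ i, r i = ((rr i : ℝ) : ℂ) := fun i =>
    Complex.ext (by simp [hrr]) (by simp [hrr, him' i])
  have hW : (∑ i, C (r i) * X i + C c : MvPolynomial (Fin 2) ℂ) = hyperplanePoly ![rr 0, rr 1] c := by
    rw [hyperplanePoly, Fin.sum_univ_two, Fin.sum_univ_two]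
    simp only [Matrix.cons_val_zero, Matrix.cons_val_one]
    rw [hr_eq 0, hr_eq 1]
  rw [hW]
  have hirr_of : ∀ i, (∀ ρ : ℚ, r i ≠ (ρ : ℂ)) → Irrational (rr i) := by
    rintro i hi ⟨ρ, hρ⟩
    exact hi ρ (by rw [hr_eq i, ← hρ]; norm_cast)
  have hirr' : Irrational (rr 0) ∨ Irrational (rr 1) := by
    rcases Fin.exists_fin_two.1 hirr with h | h
    · exact Or.inl (hirr_of 0 h)
    · exact Or.inr (hirr_of 1 h)
  exact unprojectedDense_polyFibredGraph_realPlane_all F (rr 0) (rr 1) hirr' c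

end PlaneAll

end Summit.Schanuel.Schanuel.Theorems
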